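import Literature.MathematicalPhysics.QuantumFieldTheory.Balaban1983to89.B7Prop3StaircaseStokesRec
import Literature.MathematicalPhysics.QuantumFieldTheory.Balaban1983to89.B7SectEFLinearisationRec
import Literature.MathematicalPhysics.QuantumFieldTheory.Balaban1983to89.B7Prop3GeneralLinearSplitRec
import Literature.MathematicalPhysics.QuantumFieldTheory.Balaban1983to89.B8Eq191FlatStencils
import Literature.MathematicalPhysics.QuantumFieldTheory.Balaban1983to89.B7Prop3GeneralLinearBound

/-!
# `Balaban1983to89.B7Prop3StaircaseStokesCovRec` — THE CURVATURE BOUND OF THE CARRIED COARSE GAUGE LETTER `λ_A` AT A REGULAR BACKGROUND `V₀` ([Balaban1985Averaging] Prop. 3 for the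
# averaging structure of [Balaban1987RG1] (0.4); road (A′), the «N2 estimate proper» `norm_lamZ_le` in covariant form): block axial gauge + flat lattice Stokes + holonomy perturbation

statement-level skeleton of published theorems with citation tags; proofs where landed; nothing here is a claim about the Yang–Mills mass gap

CITATION HEADER (lean-in-tree rule).  Cell `pub-ymgap`, seat `pub-ymgap-dag-n05-e` g36 (N05-REC LEAD PEN); item R1 ([3] layer), road (A′) of director-ym №257∕№265∕№266: the N2 ESTIMATE at
a REGULAR background (the levels `j ≥ 1` of [Balaban1985RegularSpaces] (1.56) run at `V₀ = Ū₀^j ≠ 1`).  `--kind proof --supports stmt-QuantumFields-20541` (K0⁷; count-neutral; no definition).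
Sources READ: [3] = [Balaban1985Averaging] pp. 18 ((8)–(9)), 24–25 ((44), (47)–(50)), 27–28 ((56)–(58)), 34 (112), 36 (124)–(126) (`paper:balaban1985-cmp98-averaging`); [I] = [Balaban1987RG1]
(0.3)–(0.4) pp. 252–253.  REUSED BY NAME: `B7Prop3StaircaseStokesRec` (flat Stokes between the two staircases, local curl hypothesis), `B7Prop1Explicit.axialFn ∕ axial_bond_bound` (the
engine's block axial gauge and its bond bound `|V₀^{ax}(b) − 1| ≤ |b₋ − y|₁·α₀`, p. 25 l. 3), `B8Lemma1NonAbelianRecLoops.walkSum` (dag-n05-d), `B7Prop3GeneralLinearBound.norm_conjR_sub_self_le`,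
`B7Prop3GeneralRotated.tsum` ((58) with the product replaced by the sum).

WHY THIS FILE.  `λ_A(y) = mean_{(r,σ)}[(R_{0,y}A)(Γ^σ_{y,x}) − (R_{0,y}A)(Γ_{y,x})]` (`B7Prop3GaugeCarryRec.lamZ`; here in its expanded form `Σ_i |IdxZ|⁻¹(R_{0,y}A)(Γ^σ) − F̂_{V₀}(y)` so that
this file imports LANDED modules only) is COVARIANT: under a gauge transformation `u` of the background and the adjoint action on `A` the rotated sums (58) transform by `R(u(y))`
(`tsum_gaugeAct`).  In the engine's block axial gauge rooted at `y` (`axialFn V₀ y`, `u(y) = 1`) the background bonds near `y` are within `|b₋ − y|₁·α₀` of `1` (`axial_bond_bound`), so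
every rotated sum along a word of length `ℓ` from `y` is within `2ℓ³α₀·|A|` of the abelian sum (`norm_tsum_sub_asum_le` + `walkSum_le_of_linear`), and the abelian curls of the rotated
perturbation are within `32(R+4)α₀·|A|` of the covariant curls `(R_{0,x}A)(∂p)`.  The flat Stokes bound of `B7Prop3StaircaseStokesRec` then gives the covariant N2 estimate:
`‖λ_A(y)‖ ≤ (d·s)²·P + 36(d·s)²(d·s + 4)·α₀·|A|`, `P` = a bound of the COVARIANT plaquette curls `‖(R_{0,x}A)(∂p)‖` on the block, `L = 2s + 1` — small in the curvature of `A` and in the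
regularity `α₀` of the background, as road (A′) requires (the `O(α₀)·|A|` part is absorbed exactly like (128)'s `cL²α₀`, SOCKET-CHECK-N2.md).
WHAT IS PROVED (sorry-free).  §1 `tstep_gaugeAct`, ★`tsum_gaugeAct` ((58) is covariant), `tsum_plaqWord_self` (degenerate plaquette); §2 ★`norm_tsum_sub_asum_le` (`‖(R_{0,x}A)(Γ) − A(Γ)‖ ≤
2|A|·|Γ|·Σ_{b⊂Γ}|V₀(b) − 1|`), `walkSum_le_of_linear` (in a gauge with `|V₀(b) − 1| ≤ |b₋ − y|₁·α` the bond costs along a word of length `ℓ` from `x` sum to `≤ ℓ(|x−y|₁ + ℓ)α`);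
§3 ★★★`norm_stairMean_sub_FhatCovZ_le` — THE COVARIANT N2 ESTIMATE `‖Σ_i |IdxZ|⁻¹(R_{0,y}A)(Γ^σ_{y,x_i}) − F̂_{V₀}(y)‖ ≤ (d·s)²·P + 36(d·s)²(d·s+4)·α₀·|A|` under the engine lineage's global
plaquette hypothesis (44)∕(52) `|V₀(∂p) − 1| ≤ α₀` and `V₀ ∈ U1`.
HONEST SCOPE.  Finite lattice bookkeeping (gauge covariance, a telescoping perturbation bound, the flat Stokes file); constants NOT optimised; nothing of [3]∕[6]∕[I] asserted; `HThm4Rec`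
UNDISCHARGED; N05 discharged of record untouched; N07 not claimable; counts unmoved (typed 28∕28 · discharged 8∕28); one finite 𝕋⁴ programme at fixed ε — nothing continuum ∕ ℝ⁴ ∕ OS ∕
mass gap ∕ Clay.  No `def`, no `instance`, no `notation`, no `sorry`.
-/

set_option autoImplicit false

noncomputable section

open scoped BigOperators
open Finset

namespace Literature.MathematicalPhysics.QuantumFieldTheory.Balaban1983to89.B7Prop3StaircaseStokesCovRec

open B7Prop1Explicit hiding Site
open B7Prop1Explicit renaming Site → SiteZ
open B7Prop3GeneralRotated
open B7Eq78Linearization (conjR conjR_apply conjR_add conjR_sub conjR_smul conjR_smul_real conjR_one)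
open B7Prop3GeneralLinearBound (norm_conjR_sub_self_le)
open B8Lemma1NonAbelianRecLoops (walkSum walkSum_nil walkSum_cons walkSum_nonneg)
open BlockAveragingZd (offZ IdxZ l1_offZ_le)
open B7SectEFLinearisationRec (FhatCovZ)
open B7Prop3GeneralLinearSplitRec (FhatCovZ_eq_sum_IdxZ)
open B8Eq191FlatStencils (conjR_unitOne)
open B7Prop3FlatRecSide (sum_IdxZ_fst norm_avgZ_le)
open B7Prop3StaircaseStokesRec (norm_asum_stairWord_sub_treeWord_le)
open T4Continuum (stairWord)
open BlockAveragingZd (length_stairWord)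

variable {d : ℕ}

variable {𝔸 : Type*} [NormedRing 𝔸]

/-! ## §1 (58) is gauge covariant -/

section Gauge

/-- One letter of (58) under a gauge transformation (8) of the background and the adjoint action on the perturbation:
`tstep_{V₀^u}(R(u)A)(x, l) = R(u(x))·tstep_{V₀}(A)(x, l)`. [cite: Balaban1985Averaging, (8) p.18, (58) p.27] -/
theorem tstep_gaugeAct (u : SiteZ d → 𝔸ˣ) (V₀ : SiteZ d → Fin d → 𝔸ˣ) (A : SiteZ d → Fin d → 𝔸) (x : SiteZ d) (l : Letter d) :
    tstep (gaugeAct u V₀) (fun z μ => conjR (u z) (A z μ)) x l = conjR (u x) (tstep V₀ A x l) := by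
  unfold tstep
  split_ifs with h
  · rfl
  · rw [stepHol_gaugeAct, conjR_mul_left, conjR_mul_left, ← conjR_mul_left (u (x + l.vec))⁻¹, inv_mul_cancel, conjR_unitOne]
    simp [conjR_apply]

/-- ★ **(58) IS GAUGE COVARIANT**: for a gauge transformation `u` of the background (8) and the adjoint action `A ↦ R(u)A` on the perturbation (`e^{R(u(x))A_b} = u(x)e^{A_b}u(x)⁻¹`),
`(R_{0,y}(R(u)A))_{V₀^u}(Γ) = R(u(y))·(R_{0,y}A)_{V₀}(Γ)` for EVERY word `Γ`. [cite: Balaban1985Averaging, (8) p.18, (58) p.27] -/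
theorem tsum_gaugeAct (u : SiteZ d → 𝔸ˣ) (V₀ : SiteZ d → Fin d → 𝔸ˣ) (A : SiteZ d → Fin d → 𝔸) :
    ∀ (y : SiteZ d) (w : List (Letter d)),
      tsum (gaugeAct u V₀) (fun z μ => conjR (u z) (A z μ)) y w = conjR (u y) (tsum V₀ A y w)
  | y, [] => by simp [conjR_apply]
  | y, l :: w => by
    rw [tsum_cons, tsum_cons, tstep_gaugeAct, tsum_gaugeAct u V₀ A (y + l.vec) w, stepHol_gaugeAct, conjR_mul_left,
      conjR_mul_left, ← conjR_mul_left (u (y + l.vec))⁻¹, inv_mul_cancel, conjR_unitOne, conjR_add]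

/-- The degenerate plaquette word `[e_μ, e_μ, −e_μ, −e_μ]` carries no rotated sum: `(R_{0,x}A)(∂p_{μμ}) = 0`. [cite: Balaban1985Averaging, (58) p.27, (44) p.24] -/
theorem tsum_plaqWord_self (V₀ : SiteZ d → Fin d → 𝔸ˣ) (A : SiteZ d → Fin d → 𝔸) (x : SiteZ d) (μ : Fin d) :
    tsum V₀ A x (plaqWord μ μ) = 0 := by
  have hw : plaqWord μ μ = seg μ ((2 : ℕ) : ℤ) ++ revWord (seg μ ((2 : ℕ) : ℤ)) := rfl
  rw [hw, tsum_append, B7Prop3GeneralLinearSplit.tsum_revWord, conjR_neg', conjR_mul_left', mul_inv_cancel, conjR_unitOne,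
    add_neg_cancel]
where
  /-- `R(X)(−Y) = −R(X)Y`. -/
  conjR_neg' (X : 𝔸ˣ) (Y : 𝔸) : conjR X (-Y) = -conjR X Y := by simp [conjR_apply]
  /-- `R(X)R(Y) = R(XY)` read backwards. -/
  conjR_mul_left' (X Y : 𝔸ˣ) (Z : 𝔸) : conjR X (conjR Y Z) = conjR (X * Y) Z := (conjR_mul_left X Y Z).symm

end Gauge

/-! ## §2 The rotated sum vs the abelian sum: a telescoping perturbation bound -/

/-- `‖A(Γ)‖ ≤ |Γ|·|A|`. [cite: Balaban1985Averaging, (125)–(126) p.36] -/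
theorem norm_asum_le'' {A : SiteZ d → Fin d → 𝔸} {a : ℝ} (hA : ∀ x κ, ‖A x κ‖ ≤ a) :
    ∀ (w : List (Letter d)) (x : SiteZ d), ‖asum A x w‖ ≤ w.length * a
  | [], x => by simp
  | l :: w, x => by
    rw [asum_cons, List.length_cons, Nat.cast_succ, add_mul, one_mul, add_comm ((w.length : ℝ) * a)]
    refine (norm_add_le _ _).trans (add_le_add ?_ (norm_asum_le'' hA w _))
    unfold stepA
    split_ifs
    · exact hA _ _
    · rw [norm_neg]; exact hA _ _

section Perturb

variable [NormOneClass 𝔸] {V : SiteZ d → Fin d → 𝔸ˣ} (hV : ∀ x κ, V x κ ∈ U1 𝔸) {A : SiteZ d → Fin d → 𝔸} {a : ℝ} (ha : 0 ≤ a)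
  (hA : ∀ x κ, ‖A x κ‖ ≤ a)
include hV ha hA

/-- One letter: `‖tstep_{V}(A)(x,l) − stepA(A)(x,l)‖ ≤ 2|V(b) − 1|·|A|` (only a reversed letter is rotated, by `R(V(b)⁻¹)`). [cite: Balaban1985Averaging, (58) p.27, (56)–(57) p.27] -/
theorem norm_tstep_sub_stepA_le (x : SiteZ d) (l : Letter d) :
    ‖tstep V A x l - stepA A x l‖ ≤ 2 * ‖((stepHol V x l : 𝔸ˣ) : 𝔸) - 1‖ * a := by
  unfold tstep stepA
  split_ifs with h
  · simp only [sub_self, norm_zero]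
    positivity
  · have e : -conjR (stepHol V x l) (A (x + l.vec) l.1) - -A (x + l.vec) l.1
        = -(conjR (stepHol V x l) (A (x + l.vec) l.1) - A (x + l.vec) l.1) := by abel
    rw [e, norm_neg]
    have := norm_conjR_sub_self_le (stepHol_mem hV x l) le_rfl (A (x + l.vec) l.1)
    exact this.trans (by gcongr; exact hA _ _)

/-- ★ **`‖(R_{0,x}A)(Γ) − A(Γ)‖ ≤ 2|A|·|Γ|·Σ_{b⊂Γ}|V(b) − 1|`** — the rotated sum (58) differs from the abelian sum by the accumulated deviation of the background transporters from `1`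
along the word (telescoping: each letter is rotated by the transport already traversed). [cite: Balaban1985Averaging, (58) p.27, (56)–(57) p.27, (125)–(126) p.36] -/
theorem norm_tsum_sub_asum_le : ∀ (w : List (Letter d)) (x : SiteZ d),
    ‖tsum V A x w - asum A x w‖ ≤ 2 * a * w.length * walkSum V x w
  | [], x => by simp
  | l :: w, x => by
    rw [tsum_cons, asum_cons, walkSum_cons, List.length_cons, Nat.cast_succ]
    have ih := norm_tsum_sub_asum_le w (x + l.vec)
    have hs := stepHol_mem hV x l
    have h1 := norm_tstep_sub_stepA_le hV ha hA x l
    have h2 : ‖conjR (stepHol V x l) (tsum V A (x + l.vec) w) - asum A (x + l.vec) w‖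
        ≤ ‖tsum V A (x + l.vec) w - asum A (x + l.vec) w‖ + 2 * ‖((stepHol V x l : 𝔸ˣ) : 𝔸) - 1‖ * (w.length * a) := by
      have e1 : conjR (stepHol V x l) (tsum V A (x + l.vec) w) - asum A (x + l.vec) w
          = conjR (stepHol V x l) (tsum V A (x + l.vec) w - asum A (x + l.vec) w)
            + (conjR (stepHol V x l) (asum A (x + l.vec) w) - asum A (x + l.vec) w) := by
        rw [conjR_sub]; abel
      rw [e1]
      refine (norm_add_le _ _).trans (add_le_add (norm_conjR_le hs _) ?_)
      refine (norm_conjR_sub_self_le hs le_rfl _).trans ?_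
      gcongr
      exact norm_asum_le'' hA _ _
    have hw0 : 0 ≤ walkSum V (x + l.vec) w := walkSum_nonneg V _ _
    have hs0 : 0 ≤ ‖((stepHol V x l : 𝔸ˣ) : 𝔸) - 1‖ := norm_nonneg _
    have hl0 : (0 : ℝ) ≤ w.length := by positivity
    calc ‖tstep V A x l + conjR (stepHol V x l) (tsum V A (x + l.vec) w) - (stepA A x l + asum A (x + l.vec) w)‖
        = ‖(tstep V A x l - stepA A x l) + (conjR (stepHol V x l) (tsum V A (x + l.vec) w) - asum A (x + l.vec) w)‖ := by
          congr 1; abel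
      _ ≤ 2 * ‖((stepHol V x l : 𝔸ˣ) : 𝔸) - 1‖ * a
          + (2 * a * w.length * walkSum V (x + l.vec) w + 2 * ‖((stepHol V x l : 𝔸ˣ) : 𝔸) - 1‖ * (w.length * a)) :=
          (norm_add_le _ _).trans (add_le_add h1 (h2.trans (add_le_add ih le_rfl)))
      _ ≤ 2 * a * (w.length + 1) * (‖((stepHol V x l : 𝔸ˣ) : 𝔸) - 1‖ + walkSum V (x + l.vec) w) := by nlinarith

omit ha hA in
/-- **Bond costs in a gauge with linear growth from a root**: if `|V(b) − 1| ≤ |b₋ − y|₁·α` for every bond (the engine's axial-gauge bound `axial_bond_bound`, p. 25 l. 3), the costs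
along a word of length `ℓ` from `x` sum to `≤ ℓ·(|x − y|₁ + ℓ)·α` (every bond met lies within `|x − y|₁ + ℓ` of the root). [cite: Balaban1985Averaging, p.25 (l.3), (44) p.24] -/
theorem walkSum_le_of_linear (y : SiteZ d) {α : ℝ} (hα : 0 ≤ α) (hlin : ∀ z μ, ‖((V z μ : 𝔸ˣ) : 𝔸) - 1‖ ≤ l1 (z - y) * α) :
    ∀ (w : List (Letter d)) (x : SiteZ d), walkSum V x w ≤ w.length * ((l1 (x - y) + w.length) * α)
  | [], x => by simp
  | l :: w, x => by
    rw [walkSum_cons, List.length_cons, Nat.cast_succ]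
    have ih := walkSum_le_of_linear y hα hlin w (x + l.vec)
    have hmove : (l1 (x + l.vec - y) : ℝ) ≤ l1 (x - y) + 1 := by
      have : l1 (x + l.vec - y) ≤ l1 (x - y) + 1 := by
        rw [show x + l.vec - y = (x - y) + l.vec by abel]
        exact (l1_add_le _ _).trans (by rw [l1_vec])
      exact_mod_cast this
    have hstep : ‖((stepHol V x l : 𝔸ˣ) : 𝔸) - 1‖ ≤ (l1 (x - y) + 1) * α := by
      unfold stepHol
      split_ifs with hb
      · refine (hlin x l.1).trans ?_
        have : (l1 (x - y) : ℝ) ≤ l1 (x - y) + 1 := by linarith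
        exact mul_le_mul_of_nonneg_right this hα
      · -- reversed letter: the bond is based at `x + l.vec = x − e_μ`
        exact (norm_inv_sub_one_le (hV _ _)).trans ((hlin _ _).trans (mul_le_mul_of_nonneg_right hmove hα))
    have hl0 : (0 : ℝ) ≤ w.length := by positivity
    have hl1 : (0 : ℝ) ≤ l1 (x - y) := by positivity
    calc ‖((stepHol V x l : 𝔸ˣ) : 𝔸) - 1‖ + walkSum V (x + l.vec) w
        ≤ (l1 (x - y) + 1) * α + w.length * ((l1 (x + l.vec - y) + w.length) * α) := add_le_add hstep ih
      _ ≤ (l1 (x - y) + 1) * α + w.length * ((l1 (x - y) + 1 + w.length) * α) := by gcongr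
      _ ≤ (w.length + 1) * ((l1 (x - y) + (w.length + 1)) * α) := by nlinarith

/-- Combining: along a word of length `ℓ` from the root itself, `‖(R_{0,y}A)(Γ) − A(Γ)‖ ≤ 2ℓ³·α·|A|`. [cite: Balaban1985Averaging, (58) p.27, p.25 (l.3), (125)–(126) p.36] -/
theorem norm_tsum_sub_asum_le_of_linear (y : SiteZ d) {α : ℝ} (hα : 0 ≤ α) (hlin : ∀ z μ, ‖((V z μ : 𝔸ˣ) : 𝔸) - 1‖ ≤ l1 (z - y) * α)
    (w : List (Letter d)) : ‖tsum V A y w - asum A y w‖ ≤ 2 * (w.length : ℝ) ^ 3 * α * a := by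
  have h1 := norm_tsum_sub_asum_le hV ha hA w y
  have h2 := walkSum_le_of_linear hV y hα hlin w y
  rw [sub_self] at h2
  have h0 : l1 (0 : SiteZ d) = 0 := by simp [l1]
  rw [h0, Nat.cast_zero, zero_add] at h2
  have hl0 : (0 : ℝ) ≤ w.length := by positivity
  calc ‖tsum V A y w - asum A y w‖ ≤ 2 * a * w.length * walkSum V y w := h1
    _ ≤ 2 * a * w.length * (w.length * (w.length * α)) := by gcongr
    _ = 2 * (w.length : ℝ) ^ 3 * α * a := by ring

/-- The abelian curl of the perturbation vs its rotated curl, from a base point `x` within `R` of the root: `‖A(∂p) − (R_{0,x}A)(∂p)‖ ≤ 32(R + 4)·α·|A|`.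
[cite: Balaban1985Averaging, (44) p.24, (58) p.27] -/
theorem norm_asum_plaq_sub_tsum_plaq_le (y : SiteZ d) {α : ℝ} (hα : 0 ≤ α) (hlin : ∀ z μ, ‖((V z μ : 𝔸ˣ) : 𝔸) - 1‖ ≤ l1 (z - y) * α)
    {R : ℕ} (x : SiteZ d) (hx : l1 (x - y) ≤ R) (μ ν : Fin d) :
    ‖asum A x (plaqWord μ ν) - tsum V A x (plaqWord μ ν)‖ ≤ 32 * ((R : ℝ) + 4) * α * a := by
  have h1 := norm_tsum_sub_asum_le hV ha hA (plaqWord μ ν) x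
  have h2 := walkSum_le_of_linear hV y hα hlin (plaqWord μ ν) x
  have hlen : (plaqWord μ ν).length = 4 := rfl
  rw [hlen] at h1 h2
  rw [← norm_neg, neg_sub]
  have hR : (l1 (x - y) : ℝ) ≤ R := by exact_mod_cast hx
  calc ‖tsum V A x (plaqWord μ ν) - asum A x (plaqWord μ ν)‖ ≤ 2 * a * (4 : ℕ) * walkSum V x (plaqWord μ ν) := h1
    _ ≤ 2 * a * (4 : ℕ) * ((4 : ℕ) * ((l1 (x - y) + (4 : ℕ)) * α)) := by gcongr
    _ ≤ 2 * a * (4 : ℕ) * ((4 : ℕ) * ((R + (4 : ℕ)) * α)) := by gcongr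
    _ = 32 * ((R : ℝ) + 4) * α * a := by push_cast; ring

end Perturb

/-! ## §3 The covariant N2 estimate: `‖λ_A(y)‖ ≤ (d·s)²·P + 36(d·s)²(d·s+4)·α₀·|A|` -/

section Cov

variable [NormedAlgebra ℂ 𝔸] [NormOneClass 𝔸] (L : ℕ)

/-- `axialFn V y y = 1`: the axial gauge function is `1` at its root (empty tree contour). [cite: Balaban1985Averaging, (82) p.30] -/
private theorem axialFn_self' {G : Type*} [Group G] (V : SiteZ d → Fin d → G) (y : SiteZ d) : axialFn V y y = 1 := by
  simp [axialFn]

/-- ★★★ **THE COVARIANT N2 ESTIMATE**: at a background `V₀ ∈ U1` with `|V₀(∂p) − 1| ≤ α₀` (the lineage's (44)∕(52)), for `|A| ≤ a` and `P` a bound of the COVARIANT plaquette curls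
`‖(R_{0,x}A)(∂p)‖` for base points within `d·s` of the block centre `y` (`L = 2s+1`):
`‖Σ_i |IdxZ|⁻¹·(R_{0,y}A)(Γ^σ_{y,x_i}) − F̂_{V₀}(y)‖ ≤ (d·s)²·P + 36(d·s)²(d·s + 4)·α₀·a`.
Proof: pass to the block axial gauge rooted at `y` (covariance, `u(y) = 1`), where every rotated staircase sum is within `2(d·s)³α₀a` of the abelian one and the abelian curls are within
`32(d·s+4)α₀a` of `P`; then the flat Stokes bound of `B7Prop3StaircaseStokesRec`. [cite: Balaban1985Averaging, (112) p.34, (124)–(126) p.36, (44) p.24, (58) p.27; Balaban1987RG1, (0.3)–(0.4) pp.252–253] -/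
theorem norm_stairMean_sub_FhatCovZ_le {s : ℕ} (hL : L = 2 * s + 1) {V₀ : SiteZ d → Fin d → 𝔸ˣ} (hV₀ : ∀ x κ, V₀ x κ ∈ U1 𝔸)
    {α : ℝ} (hα : 0 ≤ α) (h44 : ∀ (x : SiteZ d) (κ μ : Fin d), κ ≠ μ → ‖((hol V₀ x (plaqWord κ μ) : 𝔸ˣ) : 𝔸) - 1‖ ≤ α)
    {A : SiteZ d → Fin d → 𝔸} {a : ℝ} (ha : 0 ≤ a) (hA : ∀ x κ, ‖A x κ‖ ≤ a) (y : SiteZ d)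
    {P : ℝ} (hP0 : 0 ≤ P) (hP : ∀ (x : SiteZ d) (μ ν : Fin d), μ ≠ ν → l1 (x - y) ≤ d * s → ‖tsum V₀ A x (plaqWord μ ν)‖ ≤ P) :
    ‖(∑ i : IdxZ d L, ((Fintype.card (IdxZ d L) : ℝ))⁻¹ • tsum V₀ A y (stairWord i.2.1 (offZ L i.1))) - FhatCovZ L V₀ A y‖
      ≤ ((d : ℝ) * s) ^ 2 * P + 36 * ((d : ℝ) * s) ^ 2 * ((d : ℝ) * s + 4) * α * a := by
  have hL1 : 1 ≤ L := by omega
  -- the block axial gauge rooted at `y`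
  set g : SiteZ d → 𝔸ˣ := axialFn V₀ y with hg
  set V' : SiteZ d → Fin d → 𝔸ˣ := gaugeAct g V₀ with hV'
  set A' : SiteZ d → Fin d → 𝔸 := fun z μ => conjR (g z) (A z μ) with hA'
  have hg1 : ∀ z, g z ∈ U1 𝔸 := fun z => axialFn_mem hV₀ y z
  have hV'1 : ∀ x κ, V' x κ ∈ U1 𝔸 := fun x κ => gaugeAct_mem hV₀ hg1 x κ
  have hA'a : ∀ x κ, ‖A' x κ‖ ≤ a := fun x κ => (norm_conjR_le (hg1 x) _).trans (hA x κ)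
  have hlin : ∀ z μ, ‖((V' z μ : 𝔸ˣ) : 𝔸) - 1‖ ≤ l1 (z - y) * α := fun z μ => axial_bond_bound V₀ hV₀ y h44 hα z μ
  -- covariance at the root: the rotated sums of (V', A') from `y` ARE those of (V₀, A)
  have hcov : ∀ w, tsum V' A' y w = tsum V₀ A y w := fun w => by
    rw [hV', hA', tsum_gaugeAct, hg, axialFn_self', conjR_unitOne]
  -- the expression as a mean of staircase differences, rewritten in the axial gauge
  rw [FhatCovZ_eq_sum_IdxZ L hL1 V₀ A y, ← Finset.sum_sub_distrib]
  simp_rw [← smul_sub]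
  refine norm_avgZ_le L hL1 _ fun i => ?_
  rw [← hcov, ← hcov]
  -- split: (tsum' − asum') + (asum' stair − asum' tree) − (tsum' tree − asum' tree)
  set n := offZ L i.1 with hn
  have hnl : l1 n ≤ d * s := l1_offZ_le hL i.1
  have hnl' : (l1 n : ℝ) ≤ d * s := by exact_mod_cast hnl
  have e1 : tsum V' A' y (stairWord i.2.1 n) - tsum V' A' y (treeWord n)
      = (tsum V' A' y (stairWord i.2.1 n) - asum A' y (stairWord i.2.1 n))
        + (asum A' y (stairWord i.2.1 n) - asum A' y (treeWord n))
        - (tsum V' A' y (treeWord n) - asum A' y (treeWord n)) := by abel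
  rw [e1]
  have t1 := norm_tsum_sub_asum_le_of_linear hV'1 ha hA'a y hα hlin (stairWord i.2.1 n)
  have t3 := norm_tsum_sub_asum_le_of_linear hV'1 ha hA'a y hα hlin (treeWord n)
  rw [length_stairWord] at t1
  rw [length_treeWord] at t3
  -- the local abelian curl bound for A' within d·s of y
  have hM : ∀ (x : SiteZ d) (μ ν : Fin d), l1 (x - y) ≤ d * s → ‖asum A' x (plaqWord μ ν)‖ ≤ P + 32 * ((d : ℝ) * s + 4) * α * a := by
    intro x μ ν hx
    by_cases hμν : μ = ν
    · subst hμν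
      rw [asum_plaqWord]
      have : A' x μ + A' (x + e μ) μ - A' (x + e μ) μ - A' x μ = 0 := by abel
      rw [this, norm_zero]; positivity
    have hc : ‖tsum V' A' x (plaqWord μ ν)‖ ≤ P := by
      rw [hV', hA', tsum_gaugeAct]
      exact (norm_conjR_le (hg1 x) _).trans (hP x μ ν hμν hx)
    have hd := norm_asum_plaq_sub_tsum_plaq_le hV'1 ha hA'a y hα hlin x hx μ ν
    calc ‖asum A' x (plaqWord μ ν)‖ ≤ ‖tsum V' A' x (plaqWord μ ν)‖ + ‖asum A' x (plaqWord μ ν) - tsum V' A' x (plaqWord μ ν)‖ :=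
          norm_le_insert' _ _
      _ ≤ P + 32 * (((d * s : ℕ) : ℝ) + 4) * α * a := add_le_add hc hd
      _ = P + 32 * ((d : ℝ) * s + 4) * α * a := by push_cast; ring
  have hM0 : 0 ≤ P + 32 * ((d : ℝ) * s + 4) * α * a := by positivity
  have t2 := norm_asum_stairWord_sub_treeWord_le A' hM0 y (d * s) hM n hnl i.2.1
  have hds0 : (0 : ℝ) ≤ (d : ℝ) * s := by positivity
  calc ‖(tsum V' A' y (stairWord i.2.1 n) - asum A' y (stairWord i.2.1 n))
        + (asum A' y (stairWord i.2.1 n) - asum A' y (treeWord n))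
        - (tsum V' A' y (treeWord n) - asum A' y (treeWord n))‖
      ≤ ‖tsum V' A' y (stairWord i.2.1 n) - asum A' y (stairWord i.2.1 n)‖
        + ‖asum A' y (stairWord i.2.1 n) - asum A' y (treeWord n)‖
        + ‖tsum V' A' y (treeWord n) - asum A' y (treeWord n)‖ := norm_sub_le_of_le (norm_add_le _ _) le_rfl
    _ ≤ 2 * (l1 n : ℝ) ^ 3 * α * a + (l1 n * l1 n * (P + 32 * ((d : ℝ) * s + 4) * α * a)) + 2 * (l1 n : ℝ) ^ 3 * α * a :=
        add_le_add (add_le_add t1 t2) t3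
    _ ≤ 2 * ((d : ℝ) * s) ^ 3 * α * a + ((d : ℝ) * s * ((d : ℝ) * s) * (P + 32 * ((d : ℝ) * s + 4) * α * a)) + 2 * ((d : ℝ) * s) ^ 3 * α * a := by
        gcongr
    _ = ((d : ℝ) * s) ^ 2 * P + 36 * ((d : ℝ) * s) ^ 2 * ((d : ℝ) * s + 4) * α * a - 16 * ((d : ℝ) * s) ^ 2 * α * a := by ring
    _ ≤ ((d : ℝ) * s) ^ 2 * P + 36 * ((d : ℝ) * s) ^ 2 * ((d : ℝ) * s + 4) * α * a := sub_le_self _ (by positivity)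

end Cov

end Literature.MathematicalPhysics.QuantumFieldTheory.Balaban1983to89.B7Prop3StaircaseStokesCovRec
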